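import Literature.Barriers.RiemannHypothesis.TuranPartialSumsAssemblyCert
import Literature.Barriers.RiemannHypothesis.TuranPartialSumsHolds
import HarnessLib

/-!
# `PlattTrudgian2016_thm11` holds: the zero-free / zero-bearing census of the sections `ζ_N` beyond `σ = 1`

Barrier catalogue `Literature/Barriers/RiemannHypothesis/` (D-0021). Proofs only (no definitions, no
named facts): the discharge of the named fact `Literature.Barriers.RiemannHypothesis.PlattTrudgian2016_thm11`
of `TuranPartialSums.lean` — D. J. Platt, T. S. Trudgian, *Zeroes of partial sums of the zeta-function*,
LMS J. Comput. Math. 19 (2016), Theorem 1.1: `ζ_N(s) = ∑_{n ≤ N} n^{−s}` has no zero in `Re s > 1` for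
`1 ≤ N ≤ 18` and `N ∈ {20, 21, 28}`, and infinitely many such zeros for every other `N ≥ 1`.

The tree already holds the two ingredients:
* `PlattTrudgian2016_thm11_iff_TuranPartialSums` (`TuranPartialSumsAssemblyCert.lean`): Theorem 1.1 as
  typed is EQUIVALENT to the barrier fact `TuranPartialSums` (every `ζ_N`, `N ≥ 29`, has a zero with
  `Re s > 1`) — the small-`N` clauses and the passage from one zero to infinitely many being proved there;
* `TuranPartialSums_holds` (`TuranPartialSumsHolds.lean`): the barrier fact itself (kernel certificates
  for `29 ≤ N ≤ 1000`, vertical-shift certificates beyond).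

This file merely transports the second along the first. Axioms: those of `TuranPartialSums_holds`
(`propext`, `Classical.choice`, `Quot.sound`, plus the `native_decide` auxiliaries `Lean.ofReduceBool` /
`Lean.trustCompiler` inherited from the certified vertical-shift assemblies, declared computational there).

## References

* [PlattTrudgian2016] D. J. Platt, T. S. Trudgian, *Zeroes of partial sums of the zeta-function*,
  LMS J. Comput. Math. 19 (2016), 37–41: Theorem 1.1 and §1.
* [Montgomery1983] H. L. Montgomery, *Zeros of approximations to the zeta function*, in: Studies in
  Pure Mathematics to the memory of Paul Turán, Birkhäuser 1983, 497–506: §2.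
-/

namespace Literature.Barriers.RiemannHypothesis

/-- **Platt–Trudgian 2016, Theorem 1.1 — DISCHARGED**: `ζ_N` is zero-free in `Re s > 1` exactly for
`1 ≤ N ≤ 18` and `N ∈ {20, 21, 28}`, and has infinitely many zeros there for every other `N ≥ 1`;
transported from `TuranPartialSums_holds` along `PlattTrudgian2016_thm11_iff_TuranPartialSums`.
[cite: PlattTrudgian2016, Theorem 1.1] -/
theorem PlattTrudgian2016_thm11_holds : PlattTrudgian2016_thm11 :=
  PlattTrudgian2016_thm11_iff_TuranPartialSums.mpr TuranPartialSums_holds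

end Literature.Barriers.RiemannHypothesis
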